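import Summits.KontsevichZagierPeriods.KontsevichZagierPeriods.Theses.ValuedFieldSpecialisation
import Literature.NumberTheory.Transcendental.KZConstantTerm

/-!
# KontsevichZagierPeriods / ValuedFieldSpecialisation — uniqueness of the constant term

Problem `KontsevichZagierPeriods`, route `ValuedFieldSpecialisation`; settles the support item
stmt-KontsevichZagierPeriods-3501 (`ConstantTermUnique`): two divergent-monomial expansions
`I_R(s) = Σ_i w_i s^{a_i} (log s)^{b_i} + c + o(1)` (`a_i < 0`, or `a_i = 0 < b_i`; `a_i ∈ ℚ`) of
the slice integral `I_R(s) = ∫_{x | (s,x) ∈ R.domain} R.integrand (s,x) dx` of an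
`(n+1)`-dimensional integral representation `R` have the same constant term `c`, so that clause
(CT1) of the route's crux `CTConstruction` is well posed.

The two hypotheses of the item are VERBATIM `Literature.NumberTheory.Transcendental.KZ.HasConstantTerm R c`
and `… R c'` (`KZ.hasConstantTerm_iff` is `Iff.rfl`), and the conclusion is
`Literature.NumberTheory.Transcendental.KZ.HasConstantTerm.unique`, itself the asymptotic-scale
lemma `Literature.Analysis.Asymptotics.eq_zero_of_tendsto_sum_divergentMonomials` (a finite real
combination of divergent monomials `s^a (log s)^b` with a finite limit at `0⁺` has limit `0`:
dominant-exponent induction) applied to the difference of the two expansions, merged over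
`Fin k ⊕ Fin k'`. Nothing about `R` is used beyond the shape of the statement.

Sources: G. Comte, J.-M. Lion, J.-P. Rolin, *Nature log-analytique du volume des
sous-analytiques*, Illinois J. Math. 44 (2000), Thm. 1 (the scale); T. Kaiser, Proc. LMS 116
(2017), Lemma 4.6 / Prop. 4.7 (the dominant-exponent argument, Puiseux-series mirror); the
uniqueness itself is folklore. Deliberately NOT here: existence of the expansion
(Comte–Lion–Rolin / Cluckers–Miller), which the item does not demand.
-/

namespace Summit.KontsevichZagierPeriods.ValuedFieldSpecialisation

/-- Route ValuedFieldSpecialisation, item stmt-KontsevichZagierPeriods-3501 (`ConstantTermUnique`,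
support): if the slice integral `I_R(s)` of an `(n+1)`-dimensional integral representation `R`
admits two expansions `I_R(s) - Σ_i w_i s^{a_i} (log s)^{b_i} → c` and
`I_R(s) - Σ_j w'_j s^{a'_j} (log s)^{b'_j} → c'` (`s → 0⁺`) over divergent monomials
(`a < 0`, or `a = 0 < b`; `a ∈ ℚ`), then `c = c'`. The hypotheses are definitionally
`KZ.HasConstantTerm R c` and `KZ.HasConstantTerm R c'` (`KZ.hasConstantTerm_iff`), and the claim is
`KZ.HasConstantTerm.unique` (divergent log-power monomials form an asymptotic scale at `0⁺`,
`Literature.Analysis.Asymptotics.eq_zero_of_tendsto_sum_divergentMonomials`).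
[Comte–Lion–Rolin 2000, Thm. 1; Kaiser 2017, Prop. 4.7] [folklore] -/
theorem constantTermUnique_proof :
    Summit.KontsevichZagierPeriods.KontsevichZagierPeriods.Theses.ValuedFieldSpecialisation.ConstantTermUnique := by
  unfold Summit.KontsevichZagierPeriods.KontsevichZagierPeriods.Theses.ValuedFieldSpecialisation.ConstantTermUnique
  intro n R c c' h h'
  exact Literature.NumberTheory.Transcendental.KZ.HasConstantTerm.unique
    ((Literature.NumberTheory.Transcendental.KZ.hasConstantTerm_iff R c).2 h)
    ((Literature.NumberTheory.Transcendental.KZ.hasConstantTerm_iff R c').2 h')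

end Summit.KontsevichZagierPeriods.ValuedFieldSpecialisation
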